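import Summits.QuantumFields.YangMills.Theorems.BalabanUVNodesK0RecordFormatNamesL
import Literature.MathematicalPhysics.QuantumFieldTheory.Balaban1983to89.B13Inv214OrbitSUN

/-!
# K0⁷ — THE RECORD-SIDE FORMAT NAMES, EDITION 14b = Q-12 (ρ1) variant (L+), JOIN-SIDE: THE DRESSED CHART `recordEmbL` — the (1.9) pair of the rooted
# minimiser RE-GAUGED by the definite site-gauge family `u_B = exp(φ_B)`, `φ_B` = the traceless (21)-Landau potential of the linearised response in the
# direction `B` — a genuine chart in `B` whose FIRST derivative is the Landau response `recordGkL`; receipts (E1′)(E2′)(E4a) by name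

Cell `ym-nodeO-ideate` ∕ `ym-balaban-port`, DEFINER seat `ym-nodeO-def-1` (gen 34), on CRIT-1 g33's Q-12b ADDENDUM (nodeO STATUS 2026-08-31T01:22:39Z (J) + 01:23:22Z):
«the join needs a DRESSED CHART `recordEmbL B :=` coordinates of `gaugeAct (u_B) (recordBgField B)` with a DEFINITE B-analytic site-gauge family `u_B` whose derivative at 0 is
`−d(landauPotC ∘ recordD)·B` … the join uses only (i) `fderiv recordEmbL 0 (single) = recordGkL` [E4a], (ii) `Repr17` transported from ιe_rooted to ιe_L by ⁸'s own `GaugeInv119`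
over the site-dependent `recordGaugeGrp` — `u_B` need NOT be residual [E2′], (iii) `recordEmbL 0 = 0` + `ContDiffAt ℝ 2 recordEmbL 0` [E1′]».  NOT on ⁷‴'s critical path (ed.14 (L)
✓p800353 suffices there).  `--kind definition --supports stmt-QuantumFields-20541 --as helper`; count-neutral.  [I] = [Balaban1987RG1], [15] = [Balaban1985Variational].

THE DRESSING (print's road (4.2) p.281 «Using the gauge transformation in (3.37), and the gauge invariance of the function E^{(j)}(X, U), we have E^{(j)}(X, U_j(□₀, exp iB)) =
E^{(j)}(X, exp iξ H_j(□₀, B))»): `recordDdir B` = the rooted response in the direction `B` (the full derivative `∂_B|₀ U_{k+1}(W_·)[B]`, entrywise); `recordPhi B x` = the TRACELESS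
part (`sl2Proj`) of the entrywise complex (21)-Landau potential `landauPotC` of `recordDdir B` at the site `x` — ℝ-LINEAR in `B` (lemma file 9: `landauPot_add ∕ _smul`); `recordDress B x
:= exp (recordPhi B x)` — a unit of `M₂(ℂ)` with determinant `exp (tr φ) = 1`, i.e. `SL(2,ℂ) = Gᶜ`-valued (`recordGaugeGrp`); `recordPairL B := (recordPairJ B)^{u_B}` by the (1.10) action
`Sect2.cAct` — so (E2′) holds BY CONSTRUCTION; `recordEmbL B` = the two-block coordinates `(sl2Coord (mlog 𝐔), sl2Coord 𝐉)` of `recordPairL B`, exactly as `recordEmbJ` reads `recordPairJ`.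
At first order: `∂_B|₀ [u_B(src) 𝐔_B(b) u_B(tgt)⁻¹] = D·B + φ′(src) − φ′(tgt)` = the Landau representative `Hr·B` (lemma file 9 `recordD_eq_recordHr_add`, the trace part being invisible
to `sl2Coord`), and the `𝐉`-block's first derivative is unchanged (`J(1) = 0`) — this is receipt (E4a), DISPLAYED here as a Prop and to be PROVED (matrix calculus through `mlog ∕ exp ∕
current` under the TokP9-reg differentiability token and `recordBgField … 0 = 1`), not asserted.

WHAT THIS FILE IS (definitions only; statement-form; NEW names):
* §23a `recordPairJ` (the (1.9) pair `(U_{k+1}(W_B), J(U_{k+1}(W_B)))` of the rooted field, as a `Sect2.CPair` — the object `recordEmbJ` coordinatises), `recordDdir`, `recordPhi`,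
  `recordDress` (+ its `Gᶜ`-membership, proved inline: `det (exp φ) = exp (tr φ)` (`B13Inv214OrbitSUN.det_exp`), `tr ∘ sl2Proj = 0`), `recordPairL`, `recordEmbL`.
* §23b receipts: (E1′) `IotaRowAtL` (`ContDiffAt ℝ 2 recordEmbL 0 ∧ recordEmbL 0 = 0`), (E2′) `DressedRowAtL` (the coordinate form `encodeCfg (recordPairL B) = recordAct (recordDress B)
  (encodeCfg (recordPairJ B))` — provable, lemma file 10), (E4a) `ResponseRowAtL` (`fderiv recordEmbL 0 (δ_l ⊗ bV a) = recordGkL a l`).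

HONEST FRAMING.  Definitions only; NOTHING of Bałaban is asserted, ported or discharged; (E4a) is a receipt, NOT proved here; 27931 ⁷‴ not yet cut∕signed; 27930⁸∕26648 LR4 SIGNED·OPEN;
K0⁷∕K-Ax OPEN; NODE O 0∕1; COUNT 8∕28 · K 1∕4 UNMOVED; finite `𝕋⁴_{L^K}` at fixed ε — NOT continuum ∕ ℝ⁴ ∕ OS; **the Yang–Mills mass gap (Clay) is NOT proved by any of this.**
No `sorry`, `instance`, `notation`; standard axioms.
-/

noncomputable section

open scoped BigOperators Matrix.Norms.L2Operator

namespace Summit.QuantumFields.YangMills.Theorems.K0RecordFormatNames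

open Literature.MathematicalPhysics.QuantumFieldTheory.Balaban1983to89
open Literature.MathematicalPhysics.QuantumFieldTheory.Balaban1983to89.Node00
open Literature.MathematicalPhysics.QuantumFieldTheory.Balaban1983to89.T4Continuum (T4Family)
open NormedSpace (exp)

variable (F : T4Family) (θ : Stage13Params F 2)

/-! ## §23a  The rooted pair, the response in a direction, the traceless Landau potential, the dressing, the dressed pair and chart -/

/-- **The (1.9) PAIR of the rooted background field** `(U_{k+1}(W_B), J(U_{k+1}(W_B)))` as a configuration pair on `T_K` — the object `recordEmbJ` coordinatises
(`𝐔`-block through `mlog`, `𝐉`-block the current). [cite: Balaban1987RG1, (1.8)–(1.9) p.261] -/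
def recordPairJ (k K : ℕ) (B : Fin (F.P K).d → Site (F.P K) (k + 1) → θ.Vβ) : Sect2.CPair (F.P K) (MatA 2) :=
  (fun b => ((recordBgField F θ k K B b : SU 2) : MatA 2), recordCurrent F θ k K B)

/-- **The rooted response IN THE DIRECTION `B`**: the derivative at `0` of the matrix entries of `B′ ↦ U_{k+1}(W_{B′})` applied to `B` (for `B = δ_l ⊗ bV a` this is `recordD … a l`).
[cite: Balaban1985Variational, Prop. 9 p.309; Balaban1987RG1, (4.35) p.290] -/
def recordDdir (k K : ℕ) (B : Fin (F.P K).d → Site (F.P K) (k + 1) → θ.Vβ) : PBond (F.P K) 0 → Fin 2 → Fin 2 → ℂ :=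
  letI := θ.instVβ₁; letI := θ.instVβ₂
  fderiv ℝ (fun B' : Fin (F.P K).d → Site (F.P K) (k + 1) → θ.Vβ =>
    fun (b : PBond (F.P K) 0) (i i' : Fin 2) => ((recordBgField F θ k K B' b : SU 2) : Matrix (Fin 2) (Fin 2) ℂ) i i') 0 B

/-- **The TRACELESS (21)-LANDAU POTENTIAL in the direction `B`**: at the site `x`, the traceless part of the entrywise complex Landau potential `landauPotC` of the response
`recordDdir B` — ℝ-linear in `B`; its lattice gradient is the pure-gauge part of the response. [cite: Balaban1985Variational, (21) p.281; Balaban1984PropagatorsII, (2.12) p.225; Balaban1987RG1, (4.2) p.281] -/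
def recordPhi (k K : ℕ) (B : Fin (F.P K).d → Site (F.P K) (k + 1) → θ.Vβ) (x : Site (F.P K) 0) : MatA 2 :=
  sl2Proj (Matrix.of fun i i' => landauPotC F k K (fun b => recordDdir F θ k K B b i i') x)

/-- **THE DRESSING `u_B`**: the `SL(2,ℂ)`-valued site gauge transformation `x ↦ exp (recordPhi B x)` (determinant `exp (tr φ) = 1`; `u_0 = 1` since `φ_0 = 0`).  Not residual in
general — the (1.19) vehicle `GaugeInv119` over `recordGaugeGrp` quantifies every `Gᶜ`-valued `u`. [cite: Balaban1987RG1, (1.10) p.262, (1.19) p.263, (4.2) p.281] -/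
def recordDress (k K : ℕ) (B : Fin (F.P K).d → Site (F.P K) (k + 1) → θ.Vβ) : recordGaugeGrp F K :=
  ⟨fun x => Beta.BackgroundVertices.expUnit ℂ (recordPhi F θ k K B x), fun x => by
    rw [B12RegularSpaces111SpecialUnitary.mem_suModel_Gc]
    show Matrix.det (exp (recordPhi F θ k K B x)) = 1
    -- `tr ∘ sl2Proj = 0` (porter PT-A-1's `BalabanUVNodesPortS1.trace_sl2Proj`, re-derived inline to keep this leaf's import cone small)
    have htr : ∀ A : MatA 2, (sl2Proj A).trace = 0 := fun A => by
      simp [sl2Proj, Matrix.trace_sub, Matrix.trace_smul, Matrix.trace_one]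
      ring
    rw [B13Inv214OrbitSUN.det_exp]
    unfold recordPhi
    rw [htr, Complex.exp_zero]⟩

/-- **THE DRESSED PAIR** `(recordPairJ B)^{u_B}` by the (1.10) action — so that «`ι_L` = `ι_J` acted on by `u_B`» holds BY CONSTRUCTION (receipt (E2′)).
[cite: Balaban1987RG1, (1.10) p.262, (4.2) p.281] -/
def recordPairL (k K : ℕ) (B : Fin (F.P K).d → Site (F.P K) (k + 1) → θ.Vβ) : Sect2.CPair (F.P K) (MatA 2) :=
  Sect2.cAct (fun x => ((recordDress F θ k K B).1 x : (MatA 2)ˣ)) (recordPairJ F θ k K B)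

/-- **`ι_L` — THE DRESSED CHART `recordEmbL F θ k K`**: `B ↦ (sl2Coord (log 𝐔_L(b)), sl2Coord 𝐉_L(b))_b` for the dressed pair `(𝐔_L, 𝐉_L) = recordPairL B` — the same two-block coordinates
`recordEmbJ` takes of the rooted pair, taken of the Landau-dressed one.  First derivative at `0` = `recordGkL` (receipt (E4a)). [cite: Balaban1987RG1, (4.2) p.281, (4.35) p.290, (1.8)–(1.9) p.261] -/
def recordEmbL (k K : ℕ) (B : Fin (F.P K).d → Site (F.P K) (k + 1) → θ.Vβ) : Fin (recordChartDimJ F K) → ℂ :=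
  fun i => Sum.elim
    (fun a => sl2Coord (MatrixLog.mlog ((recordPairL F θ k K B).1 ((chartEquivJ F K).symm i).1)) a)
    (fun a => sl2Coord ((recordPairL F θ k K B).2 ((chartEquivJ F K).symm i).1) a)
    ((chartEquivJ F K).symm i).2

/-! ## §23b  Receipts (E1′) ∕ (E2′) ∕ (E4a) — Prop-valued, assert nothing -/

/-- **RECEIPT (E1′) `IotaRowAtL`**: the dressed chart is `C²` at `0` and vanishes there (27931's (C2a)(C2b) shape for `ι_L`). [cite: Balaban1987RG1, (4.35) p.290; Balaban1985Variational, Prop. 9 p.309] -/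
def IotaRowAtL (k K : ℕ) : Prop :=
  letI := θ.instVβ₁; letI := θ.instVβ₂
  ContDiffAt ℝ 2 (recordEmbL F θ k K) 0 ∧ recordEmbL F θ k K 0 = 0

/-- **RECEIPT (E2′) `DressedRowAtL`**, coordinate form: the coordinates of the dressed pair are the (1.10) action `recordAct` of the dressing on the coordinates of the rooted pair
(holds by construction up to `decode ∘ encode = id`; lemma file 10). [cite: Balaban1987RG1, (1.10) p.262, (4.2) p.281] -/
def DressedRowAtL (k K : ℕ) : Prop :=
  ∀ B : Fin (F.P K).d → Site (F.P K) (k + 1) → θ.Vβ,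
    encodeCfg F K (recordPairL F θ k K B) = recordAct F K (recordDress F θ k K B) (encodeCfg F K (recordPairJ F θ k K B))

/-- **RECEIPT (E4a) `ResponseRowAtL`**: the FIRST DERIVATIVE of the dressed chart at `0` on the basis fields IS the Landau response `recordGkL` (𝐔-block = `Hr`, 𝐉-block unchanged).
To be PROVED (matrix calculus through `mlog ∕ exp ∕ current` under TokP9-reg and `U_{k+1}(W_0) = 1`); displayed, not asserted. [cite: Balaban1985Variational, Prop. 9 p.309, (21) p.281; Balaban1987RG1, (4.35) p.290] -/
def ResponseRowAtL (k K : ℕ) (a : θ.ιβ) : Prop :=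
  letI := θ.instVβ₁; letI := θ.instVβ₂; letI := θ.instιβ
  ∀ (l : RespLabel F k K) (i : Fin (recordChartDimJ F K)),
    fderiv ℝ (recordEmbL F θ k K) 0 (Pi.single l.1 (Pi.single l.2 (θ.bV a))) i = recordGkL F θ k K a l i

end Summit.QuantumFields.YangMills.Theorems.K0RecordFormatNames

end
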